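import Mathlib.RingTheory.MvPolynomial.WeightedHomogeneous
import Mathlib.RingTheory.Ideal.Operations
import Mathlib.Data.Fin.VecNotation
import Literature.Computability.AlgebraicComplexity.BrentEquations
import HarnessLib

/-!
# Torus weights of the Brent system and weight-zero Nullstellensatz refutations

Topic: `Literature/Computability/AlgebraicComplexity`. Complement to `BrentEquations.lean`
(definition request `defn-HasNSRefutation`, route MatrixMultiplication/BrentRefutationDepth): the
API that file lists as "not here" — **invariance of refutability under the torus `(Kˣ)^{2r}` /
the weight-`0` projection of multipliers** — plus the product-degree bound and two small
soundness/completeness facts for the tree's general notion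
`Literature.Computability.Complexity.HasNSRefutationWithMultipliersOfDegree`
(`Complexity/NullstellensatzRefutation.lean`). Everything is proved; no named facts.

## Content

* General (any grading `w : σ → M` by an additive commutative monoid): the weight-`n` component of
  `p · q` for `q` weighted-homogeneous of weight `0` is `p_n · q`
  (`weightedHomogeneousComponent_mul_of_isWeightedHomogeneous_zero`); components do not raise the
  total degree (`totalDegree_weightedHomogeneousComponent_le`); hence the **weight-zero
  projection**: if every axiom `𝒜 a` is weighted-homogeneous of weight `0`, projecting the
  multipliers of a refutation `∑ g_a 𝒜_a = 1` to weight `0` gives a refutation by weight-`0`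
  multipliers of no larger degree, `∑ (g_a)_0 𝒜_a = (∑ g_a 𝒜_a)_0 = 1_0 = 1`
  (`HasNSRefutationWithMultipliersOfDegree.exists_isWeightedHomogeneous_zero`, Finset form;
  `….exists_forall_isWeightedHomogeneous_zero`, `Fintype` form; `…_iff_…`).
* General: soundness in algebras (`….exists_aeval_ne_zero`: no common zero in any nontrivial
  commutative `K`-algebra, e.g. `ℚ`-certificates refute complex solutions) and
  `1 ∈ (𝒜)` (`….one_mem_span`; `exists_hasNSRefutationWithMultipliersOfDegree_iff_one_mem_span`:
  refutable in some degree iff the axioms generate the unit ideal — the degree-free content of an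
  NS refutation, Krajíček 2019 §6.2 "NS is sound and complete" for ideal membership).
* Brent system (`brentSystem K n r`, `HasBrentRefutation K n r D` of `BrentEquations.lean`):
  `totalDegree_brentSystem_le` (each equation is a cubic), so a multiplier-degree-`D` refutation
  is a Krajíček-degree-`(D+3)` one (`HasBrentRefutation.hasNSRefutationOfDegree`); the **torus
  grading** `brentTorusWeight n r : unknowns → ℤ^r × ℤ^r`, `a_{t,i} ↦ (e_t, 0)`,
  `b_{t,j} ↦ (0, e_t)`, `c_{t,k} ↦ (−e_t, −e_t)` — the character by which the rescaling torus
  `(Kˣ)^r × (Kˣ)^r`, `a_t ↦ λ_t a_t, b_t ↦ μ_t b_t, c_t ↦ (λ_t μ_t)⁻¹ c_t` (which fixes every triad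
  `a_t ⊗ b_t ⊗ c_t`, hence maps schemes to schemes) acts on each unknown; every Brent equation is
  weighted-homogeneous of weight `0` (`brentSystem_isWeightedHomogeneous`); therefore
  **refutations of `B(n, r)` may be taken with torus-invariant (weight-`0`) multipliers of the same
  degree** (`HasBrentRefutation.exists_torusInvariant`, `hasBrentRefutation_iff_exists_torusInvariant`)
  — the "WeightZeroReduction" step foreseen by the route (its items `TwoBySixDepth`,
  `NoLinearDepthRefutation` argue on weight-`0` multipliers).

## Sources

* J. Krajíček, *Proof Complexity*, Encyclopedia Math. Appl. 170, CUP 2019, §6.2 (NS proofs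
  `g = ∑ h_f f`, (6.2.2); "NS/F is sound and complete"; degree of an NS-proof).
  [KrajicekProofComplexity2019]
* M. J. H. Heule, M. Kauers, M. Seidl, *New ways to multiply 3 × 3-matrices*, J. Symbolic Comput.
  104 (2021), §2 (the Brent equations; cubic equations). [HeuleKauersSeidl2021]
* The torus rescaling symmetry of tensor decompositions and the graded-component argument are
  standard (de Groote 1978 describes the full isotropy group of `⟨n,n,n⟩`-algorithms); tagged
  `[folklore]`.

## Design choices; not here

* Gradings are by an arbitrary `AddCommMonoid M` (no cancellation needed when the axioms have
  weight `0`); the torus lattice is `(Fin r → ℤ) × (Fin r → ℤ)`.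
* NOT here: the full isotropy group `GL_n³ ⋊ (ℤ₃ ⋊ ℤ₂) × S_r` and symmetrisation over FINITE
  groups (Gatermann–Parrilo style averaging needs `char K ∤ |G|`; the torus needs nothing), the
  description of weight-`0` monomials (products of `a_{t,i} b_{t,j} c_{t,k}`, so weight-`0`
  multipliers have degree in `3ℕ`), degree lower bounds.
-/

noncomputable section

open MvPolynomial Finset
open Literature.Computability.Complexity

namespace Literature.Computability.AlgebraicComplexity

universe u

/-! ## Weighted components of products with a weight-zero factor -/

section Components

variable {σ R M : Type*} [CommSemiring R] [AddCommMonoid M]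

/-- The weight-`n` component of `p · q` for `q` weighted-homogeneous of weight `0` is `p_n · q`.
[folklore] -/
theorem weightedHomogeneousComponent_mul_of_isWeightedHomogeneous_zero (w : σ → M) (n : M)
    (p : MvPolynomial σ R) {q : MvPolynomial σ R} (hq : IsWeightedHomogeneous w q 0) :
    weightedHomogeneousComponent w n (p * q) = weightedHomogeneousComponent w n p * q := by
  classical
  ext d
  rw [coeff_weightedHomogeneousComponent, coeff_mul, coeff_mul]
  simp_rw [coeff_weightedHomogeneousComponent]
  split_ifs with hd
  · refine Finset.sum_congr rfl fun x hx => ?_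
    by_cases hq0 : coeff x.2 q = 0
    · rw [hq0, mul_zero, mul_zero]
    · have h2 : Finsupp.weight w x.2 = 0 := hq hq0
      have h1 : Finsupp.weight w x.1 = n := by
        rw [Finset.HasAntidiagonal.mem_antidiagonal] at hx
        rw [← hd, ← hx, map_add, h2, add_zero]
      rw [if_pos h1]
  · symm
    refine Finset.sum_eq_zero fun x hx => ?_
    by_cases hq0 : coeff x.2 q = 0
    · rw [hq0, mul_zero]
    · have h2 : Finsupp.weight w x.2 = 0 := hq hq0
      rw [if_neg, zero_mul]
      intro h1
      apply hd
      rw [Finset.HasAntidiagonal.mem_antidiagonal] at hx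
      rw [← hx, map_add, h1, h2, add_zero]

/-- Taking a weighted-homogeneous component does not raise the total degree (its support is a
subset). [folklore] -/
theorem totalDegree_weightedHomogeneousComponent_le (w : σ → M) (n : M) (p : MvPolynomial σ R) :
    (weightedHomogeneousComponent w n p).totalDegree ≤ p.totalDegree := by
  classical
  refine totalDegree_le_of_support_subset fun d hd => ?_
  rw [mem_support_iff, coeff_weightedHomogeneousComponent] at hd
  rw [mem_support_iff]
  split_ifs at hd with h
  · exact hd
  · exact absurd rfl hd

/-- The weight-`0` component of a sum `∑_{a ∈ s} g_a 𝒜_a` with weight-`0` axioms `𝒜_a` is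
`∑_{a ∈ s} (g_a)_0 𝒜_a`. [folklore] -/
theorem weightedHomogeneousComponent_zero_sum_mul {ι : Type*} (w : σ → M) (s : Finset ι)
    (g 𝒜 : ι → MvPolynomial σ R) (h𝒜 : ∀ a, IsWeightedHomogeneous w (𝒜 a) 0) :
    weightedHomogeneousComponent w 0 (∑ a ∈ s, g a * 𝒜 a) =
      ∑ a ∈ s, weightedHomogeneousComponent w 0 (g a) * 𝒜 a := by
  rw [map_sum]
  exact Finset.sum_congr rfl fun a _ =>
    weightedHomogeneousComponent_mul_of_isWeightedHomogeneous_zero w 0 (g a) (h𝒜 a)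

end Components

/-! ## General facts on `HasNSRefutationWithMultipliersOfDegree` -/

section General

variable {ι σ K : Type*} [CommRing K]

/-- **Soundness in algebras**: a system with an NS refutation over `K` has no common zero in any
nontrivial commutative `K`-algebra `L` (evaluate `∑ g_a 𝒜_a = 1` there: `0 = 1`); e.g. a
rational certificate excludes complex solutions. Dot-notation extension of the tree's notion
(declared in `Complexity/NullstellensatzRefutation.lean`).
[cite: KrajicekProofComplexity2019, §6.2 (NS is sound)] -/
theorem _root_.Literature.Computability.Complexity.HasNSRefutationWithMultipliersOfDegree.exists_aeval_ne_zero
    {L : Type*} [CommRing L] [Algebra K L] [Nontrivial L] {𝒜 : ι → MvPolynomial σ K} {D : ℕ}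
    (h : HasNSRefutationWithMultipliersOfDegree 𝒜 D) (x : σ → L) : ∃ a, aeval x (𝒜 a) ≠ 0 := by
  obtain ⟨s, g, hsum, -⟩ := h
  by_contra hall
  simp only [not_exists, not_not] at hall
  simpa [map_mul, hall] using congrArg (aeval x) hsum

/-- A refuted system generates the unit ideal: `1 ∈ (𝒜_a : a)`.
[cite: KrajicekProofComplexity2019, §6.2 (NS is sound and complete)] -/
theorem _root_.Literature.Computability.Complexity.HasNSRefutationWithMultipliersOfDegree.one_mem_span
    {𝒜 : ι → MvPolynomial σ K} {D : ℕ} (h : HasNSRefutationWithMultipliersOfDegree 𝒜 D) :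
    (1 : MvPolynomial σ K) ∈ Ideal.span (Set.range 𝒜) := by
  obtain ⟨s, g, hsum, -⟩ := h
  rw [← hsum]
  exact Ideal.sum_mem _ fun a _ => Ideal.mul_mem_left _ _ (Ideal.subset_span ⟨a, rfl⟩)

/-- A refuted system generates the unit ideal. [cite: KrajicekProofComplexity2019, §6.2] -/
theorem _root_.Literature.Computability.Complexity.HasNSRefutationWithMultipliersOfDegree.span_eq_top
    {𝒜 : ι → MvPolynomial σ K} {D : ℕ} (h : HasNSRefutationWithMultipliersOfDegree 𝒜 D) :
    Ideal.span (Set.range 𝒜) = ⊤ :=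
  (Ideal.eq_top_iff_one _).2 h.one_mem_span

/-- **The degree-free content of an NS refutation is ideal membership**: `𝒜` is refutable with
multipliers of SOME degree iff `1 ∈ (𝒜)` (write `1 = ∑ c_a 𝒜_a` with finitely supported `c` and
take `D = max deg c_a`). Krajíček 2019, §6.2: NS is sound and complete for ideal membership.
[cite: KrajicekProofComplexity2019, §6.2 (NS is sound and complete)] -/
theorem exists_hasNSRefutationWithMultipliersOfDegree_iff_one_mem_span (𝒜 : ι → MvPolynomial σ K) :
    (∃ D, HasNSRefutationWithMultipliersOfDegree 𝒜 D) ↔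
      (1 : MvPolynomial σ K) ∈ Ideal.span (Set.range 𝒜) := by
  constructor
  · rintro ⟨D, h⟩
    exact h.one_mem_span
  · intro h1
    obtain ⟨c, hc⟩ := Finsupp.mem_ideal_span_range_iff_exists_finsupp.1 h1
    refine ⟨c.support.sup fun a => (c a).totalDegree, c.support, c, hc, fun a ha => ?_⟩
    exact Finset.le_sup (f := fun a => (c a).totalDegree) ha

variable {M : Type*} [AddCommMonoid M]

/-- **Weight-zero projection** (Finset form). If every axiom `𝒜_a` is weighted-homogeneous of
weight `0` for a grading `w : σ → M` (e.g. invariant under a torus acting diagonally on the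
variables with character lattice `M`), then projecting the multipliers of a refutation to their
weight-`0` components gives a refutation BY WEIGHT-`0` MULTIPLIERS of no larger total degree:
`∑ (g_a)_0 𝒜_a = (∑ g_a 𝒜_a)_0 = 1`. [folklore] -/
theorem _root_.Literature.Computability.Complexity.HasNSRefutationWithMultipliersOfDegree.exists_isWeightedHomogeneous_zero
    (w : σ → M) {𝒜 : ι → MvPolynomial σ K} {D : ℕ} (h𝒜 : ∀ a, IsWeightedHomogeneous w (𝒜 a) 0)
    (h : HasNSRefutationWithMultipliersOfDegree 𝒜 D) :
    ∃ (s : Finset ι) (g : ι → MvPolynomial σ K), (∑ a ∈ s, g a * 𝒜 a) = 1 ∧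
      (∀ a ∈ s, (g a).totalDegree ≤ D) ∧ ∀ a, IsWeightedHomogeneous w (g a) 0 := by
  obtain ⟨s, g, hsum, hdeg⟩ := h
  refine ⟨s, fun a => weightedHomogeneousComponent w 0 (g a), ?_,
    fun a ha => (totalDegree_weightedHomogeneousComponent_le w 0 (g a)).trans (hdeg a ha),
    fun a => weightedHomogeneousComponent_isWeightedHomogeneous 0 (g a)⟩
  rw [← weightedHomogeneousComponent_zero_sum_mul w s g 𝒜 h𝒜, hsum]
  exact (isWeightedHomogeneous_one K w).weightedHomogeneousComponent_same

/-- **Weight-zero projection** (`Fintype` form, total multiplier function). [folklore] -/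
theorem _root_.Literature.Computability.Complexity.HasNSRefutationWithMultipliersOfDegree.exists_forall_isWeightedHomogeneous_zero
    [Fintype ι] (w : σ → M) {𝒜 : ι → MvPolynomial σ K} {D : ℕ}
    (h𝒜 : ∀ a, IsWeightedHomogeneous w (𝒜 a) 0) (h : HasNSRefutationWithMultipliersOfDegree 𝒜 D) :
    ∃ g : ι → MvPolynomial σ K, (∀ a, IsWeightedHomogeneous w (g a) 0) ∧
      (∀ a, (g a).totalDegree ≤ D) ∧ (∑ a, g a * 𝒜 a) = 1 := by
  obtain ⟨g, hdeg, hsum⟩ := (hasNSRefutationWithMultipliersOfDegree_iff_forall 𝒜 D).1 h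
  refine ⟨fun a => weightedHomogeneousComponent w 0 (g a),
    fun a => weightedHomogeneousComponent_isWeightedHomogeneous 0 (g a),
    fun a => (totalDegree_weightedHomogeneousComponent_le w 0 (g a)).trans (hdeg a), ?_⟩
  rw [← weightedHomogeneousComponent_zero_sum_mul w Finset.univ g 𝒜 h𝒜, hsum]
  exact (isWeightedHomogeneous_one K w).weightedHomogeneousComponent_same

/-- For weight-`0` systems, refutability in multiplier degree `D` is equivalent to refutability by
weight-`0` (invariant) multipliers of degree `≤ D`. [folklore] -/
theorem hasNSRefutationWithMultipliersOfDegree_iff_exists_isWeightedHomogeneous_zero [Fintype ι]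
    (w : σ → M) {𝒜 : ι → MvPolynomial σ K} (h𝒜 : ∀ a, IsWeightedHomogeneous w (𝒜 a) 0) (D : ℕ) :
    HasNSRefutationWithMultipliersOfDegree 𝒜 D ↔
      ∃ g : ι → MvPolynomial σ K, (∀ a, IsWeightedHomogeneous w (g a) 0) ∧
        (∀ a, (g a).totalDegree ≤ D) ∧ (∑ a, g a * 𝒜 a) = 1 :=
  ⟨fun h => h.exists_forall_isWeightedHomogeneous_zero w h𝒜,
    fun ⟨g, _, hdeg, hsum⟩ => (hasNSRefutationWithMultipliersOfDegree_iff_forall 𝒜 D).2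
      ⟨g, hdeg, hsum⟩⟩

end General

/-! ## The Brent system: degrees and torus weights -/

section Brent

variable {K : Type u} [CommRing K]

/-- Each Brent equation is a cubic: `deg B_{ijk} ≤ 3` ("`n⁶` cubic equations", Heule–Kauers–Seidl
§2). [cite: HeuleKauersSeidl2021, §2 (the Brent equations)] -/
theorem totalDegree_brentSystem_le (n r : ℕ) (i j k : Fin n × Fin n) :
    (brentSystem K n r i j k).totalDegree ≤ 3 := by
  have hX : ∀ v : Fin 3 × Fin r × (Fin n × Fin n),
      (X v : MvPolynomial (Fin 3 × Fin r × (Fin n × Fin n)) K).totalDegree ≤ 1 := by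
    intro v
    show (monomial (Finsupp.single v 1) (1 : K)).totalDegree ≤ 1
    exact (totalDegree_monomial_le _ _).trans (by simp)
  refine (totalDegree_sub_C_le _ _).trans (totalDegree_finsetSum_le fun t _ => ?_)
  exact (totalDegree_mul _ _).trans
    (add_le_add ((totalDegree_mul _ _).trans (add_le_add (hX _) (hX _))) (hX _))

/-- Hence a refutation of `B(n, r)` with multipliers of degree `≤ D` is an NS refutation of
Krajíček-degree `≤ D + 3` (products `g · B` of degree `≤ D + 3`).
[cite: KrajicekProofComplexity2019, §6.2 (deg(π) = max deg(h_f f))] -/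
theorem HasBrentRefutation.hasNSRefutationOfDegree {n r D : ℕ} (h : HasBrentRefutation K n r D) :
    HasNSRefutationOfDegree (fun e : (Fin n × Fin n) × (Fin n × Fin n) × (Fin n × Fin n) =>
      brentSystem K n r e.1 e.2.1 e.2.2) (D + 3) :=
  hasNSRefutationOfDegree_of_multipliers h fun e => totalDegree_brentSystem_le n r e.1 e.2.1 e.2.2

/-- **Torus weights.** The weight (character) of each unknown of `B(n, r)` under the rescaling
torus `(Kˣ)^r × (Kˣ)^r`, `a_t ↦ λ_t a_t`, `b_t ↦ μ_t b_t`, `c_t ↦ (λ_t μ_t)⁻¹ c_t`, as an element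
of the weight lattice `ℤ^r × ℤ^r`: `a_{t,i} ↦ (e_t, 0)`, `b_{t,j} ↦ (0, e_t)`,
`c_{t,k} ↦ (−e_t, −e_t)`. A monomial has weight `0` iff, for every `t`, it has as many `a_{t,·}`
as `b_{t,·}` as `c_{t,·}` factors. [folklore] -/
def brentTorusWeight (n r : ℕ) : Fin 3 × Fin r × (Fin n × Fin n) → (Fin r → ℤ) × (Fin r → ℤ) :=
  fun p => ![(Pi.single p.2.1 1, 0), (0, Pi.single p.2.1 1),
    (-Pi.single p.2.1 1, -Pi.single p.2.1 1)] p.1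

/-- The weights of `a_{t,i}`, `b_{t,j}`, `c_{t,k}`. [folklore] -/
theorem brentTorusWeight_apply (n r : ℕ) (t : Fin r) (i j k : Fin n × Fin n) :
    brentTorusWeight n r (0, t, i) = (Pi.single t 1, 0) ∧
      brentTorusWeight n r (1, t, j) = (0, Pi.single t 1) ∧
        brentTorusWeight n r (2, t, k) = (-Pi.single t 1, -Pi.single t 1) := by
  simp [brentTorusWeight]

/-- The three unknowns of one triad monomial `a_{t,i} b_{t,j} c_{t,k}` have weights summing to
`0`. [folklore] -/
theorem brentTorusWeight_sum_eq_zero (n r : ℕ) (t : Fin r) (i j k : Fin n × Fin n) :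
    brentTorusWeight n r (0, t, i) + brentTorusWeight n r (1, t, j) +
      brentTorusWeight n r (2, t, k) = 0 := by
  simp [brentTorusWeight]

/-- **Torus invariance of the Brent system**: every Brent equation
`∑_t a_{t,i} b_{t,j} c_{t,k} − ⟨n,n,n⟩_{ijk}` is weighted-homogeneous of weight `0` for the torus
grading. [folklore] -/
theorem brentSystem_isWeightedHomogeneous (n r : ℕ) (i j k : Fin n × Fin n) :
    IsWeightedHomogeneous (brentTorusWeight n r) (brentSystem K n r i j k) 0 := by
  refine (weightedHomogeneousSubmodule K (brentTorusWeight n r) 0).sub_mem ?_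
    (isWeightedHomogeneous_C _ _)
  refine IsWeightedHomogeneous.sum _ _ _ fun t _ => ?_
  rw [← brentTorusWeight_sum_eq_zero n r t i j k]
  exact ((isWeightedHomogeneous_X K _ _).mul (isWeightedHomogeneous_X K _ _)).mul
    (isWeightedHomogeneous_X K _ _)

/-- **Refutations of `B(n, r)` may be taken torus-invariant** ("WeightZeroReduction"): from any
refutation with multipliers of degree `≤ D`, projecting each multiplier to torus weight `0` gives
one by weight-`0` multipliers of degree `≤ D`. [folklore] -/
theorem HasBrentRefutation.exists_torusInvariant {n r D : ℕ} (h : HasBrentRefutation K n r D) :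
    ∃ g : (Fin n × Fin n) × (Fin n × Fin n) × (Fin n × Fin n) →
        MvPolynomial (Fin 3 × Fin r × (Fin n × Fin n)) K,
      (∀ e, IsWeightedHomogeneous (brentTorusWeight n r) (g e) 0) ∧
        (∀ e, (g e).totalDegree ≤ D) ∧ (∑ e, g e * brentSystem K n r e.1 e.2.1 e.2.2) = 1 :=
  HasNSRefutationWithMultipliersOfDegree.exists_forall_isWeightedHomogeneous_zero
    (brentTorusWeight n r) (fun e => brentSystem_isWeightedHomogeneous n r e.1 e.2.1 e.2.2) h

/-- `D_NS(n, r) ≤ D` iff `B(n, r)` has a refutation by TORUS-INVARIANT multipliers of degree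
`≤ D`. [folklore] -/
theorem hasBrentRefutation_iff_exists_torusInvariant (n r D : ℕ) :
    HasBrentRefutation K n r D ↔
      ∃ g : (Fin n × Fin n) × (Fin n × Fin n) × (Fin n × Fin n) →
          MvPolynomial (Fin 3 × Fin r × (Fin n × Fin n)) K,
        (∀ e, IsWeightedHomogeneous (brentTorusWeight n r) (g e) 0) ∧
          (∀ e, (g e).totalDegree ≤ D) ∧ (∑ e, g e * brentSystem K n r e.1 e.2.1 e.2.2) = 1 := by
  refine ⟨fun h => h.exists_torusInvariant, fun ⟨g, _, hdeg, hsum⟩ => ?_⟩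
  exact (hasNSRefutationWithMultipliersOfDegree_iff_forall
    (fun e : (Fin n × Fin n) × (Fin n × Fin n) × (Fin n × Fin n) =>
      brentSystem K n r e.1 e.2.1 e.2.2) D).2 ⟨g, hdeg, hsum⟩

end Brent

end Literature.Computability.AlgebraicComplexity

end
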